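import Mathlib.Analysis.SpecialFunctions.Log.Basic
import Mathlib.Algebra.Order.BigOperators.Group.Finset
import Mathlib.Algebra.BigOperators.Ring.Finset
import Mathlib.NumberTheory.Primorial
import HarnessLib

/-!
# [IUTchIV] Theorem 1.10, Step (iii): the bound on `log(𝔰^ℚ)` assembled from the places of `F_tpd`

Mochizuki, *Inter-universal Teichmüller theory IV*, RIMS manuscript (Apr. 2020; = PRIMS **57** (2021)),
proof of Thm. 1.10, Step (iii), pp. 24–26. The distinguished rational primes are those that ramify in `K`
((D4) ⟺ (D5)), equivalently ((D6)): "Either `p_{v_ℚ} | 2·3·5·l` or `v_ℚ` lies in the image of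
`Supp(𝔮^{F_tpd}_ADiv + 𝔡^{F_tpd}_ADiv)`"; `𝔰^ℚ_ADiv := Σ_{w_ℚ ∈ V(ℚ)^dst} w_ℚ`, `log(𝔰^ℚ) = Σ_{p dst} log p`;
and (p. 26): "it follows immediately from Proposition 1.3, (i), by considering the various possibilities
for elements `∈ Supp(𝔰_ADiv)`, that … In a similar vein, we conclude that
`log(𝔰^ℚ) ≤ 2·d_mod·(log(𝔡^{F_tpd}) + log(𝔣^{F_tpd})) + log(2·3·5·l)`".

**SCOPE / DEPRECATION (referee flag on p406813).** This single-level version indexes the places of `F_tpd`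
and carries the hypothesis `deg0_le_dmod : [F_tpd:ℚ] ≤ d_mod`; since in print `F_mod ⊆ F_tpd := F_mod(E_{F_mod}[2])`
(p. 22), hence `[F_tpd:ℚ] = [F_tpd:F_mod]·d_mod ≥ d_mod`, that hypothesis restricts this file to the DEGENERATE
case `F_tpd = F_mod` (all of `E_{F_mod}[2]` rational over `F_mod`). The general, faithful assembly — over the
tower `F_mod ⊆ F_tpd`, where the printed factor `2` and the appearance of `d_mod` (rather than `[F_tpd:ℚ]`) are
explained by the local inequality `([F_tpd:F_mod]/2)·log p ≤ topTerm` — is `Theorem110StepIIITower.lean`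
(`Thm110StepIII.StepIIITower.logsQ_le`); use that file. The declarations below are kept (they are correct as
stated and are instantiated by the cell's checks file) but should not be cited for the general case.

Original description. This file kernel-checks that assembly (the field `sQ_le` of `Thm110Numerics.ProofData`,
`Theorem110Data.lean`) from per-place inputs, IN THE CASE `F_tpd = F_mod`: the places `v` of `F_tpd` with residue characteristic
`p_v`, `e_v`, `f_v`, normalised different exponent `d_v ≥ 0` and bad/good reduction, `[F_tpd:ℚ] ≤ d_mod`,
the fundamental inequality `Σ_{v|p} e_v f_v ≤ [F_tpd:ℚ]`, Prop. 1.3 (i) over `ℚ_p` (`d_v ≥ (e_v − 1)/e_v`),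
"`d_v > 0 ⟹ v` ramified (`e_v ≥ 2`)", and (D6) for the set of distinguished primes (`StepIIIData`).
PROVED: `logsQ_le` — the SHARPER `log(𝔰^ℚ) ≤ d_mod·(log(𝔡^{F_tpd}) + log(𝔣^{F_tpd})) + log(2·3·5·l)`
(a distinguished `p ∤ 30l` lies under a bad place, contributing `≥ log p` to `[F_tpd:ℚ]·log(𝔣)`, or under a
ramified one, contributing `e_v f_v d_v·log p ≥ (e_v − 1)f_v·log p ≥ log p` to `[F_tpd:ℚ]·log(𝔡)`; the primes
dividing `30l` contribute `≤ log(30l)`), and the printed form `logsQ_le_printed` (factor `2`).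
Prop. 1.3 (i), Prop. 1.8 and (D0)–(D6) themselves are inputs, not proved here; nothing on Cor. 3.12.
-/

noncomputable section

namespace Literature.IUT.LogVolume

namespace Thm110StepIII

open Finset Real

/-- The places of `F_tpd` and the distinguished rational primes, with the printed local inputs of Step (iii)
— DEGENERATE CASE `F_tpd = F_mod` ONLY (field `deg0_le_dmod`); general case: `Thm110StepIII.StepIIITower`.
[claim: Mochizuki2012, status: disputed] -/
structure StepIIIData (V : Type*) [Fintype V] where
  /-- `[F_tpd : ℚ]` -/
  deg0 : ℝ
  /-- `[F_tpd : ℚ] > 0` -/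
  deg0_pos : 0 < deg0
  /-- `d_mod = [F_mod : ℚ]` -/
  dmod : ℝ
  /-- `[F_tpd : ℚ] ≤ d_mod` — WARNING: in print `F_mod ⊆ F_tpd`, so this holds only in the degenerate case
  `F_tpd = F_mod`; see the module docstring and `Theorem110StepIIITower.lean` for the general case -/
  deg0_le_dmod : deg0 ≤ dmod
  /-- the prime `l` -/
  l : ℕ
  /-- `l ≥ 1` -/
  l_pos : 0 < l
  /-- residue characteristic of the place `v` -/
  p : V → ℕ
  /-- it is a prime -/
  p_prime : ∀ v, (p v).Prime
  /-- absolute ramification index -/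
  e : V → ℕ
  /-- `e_v ≥ 1` -/
  e_pos : ∀ v, 0 < e v
  /-- absolute residue degree -/
  f : V → ℕ
  /-- `f_v ≥ 1` -/
  f_pos : ∀ v, 0 < f v
  /-- different exponent of `(F_tpd)_v/ℚ_p`, normalised by `ord(p) = 1` -/
  d : V → ℝ
  /-- `d_v ≥ 0` -/
  d_nonneg : ∀ v, 0 ≤ d v
  /-- bad multiplicative reduction at `v` (`v ∈ Supp(𝔮^{F_tpd}_ADiv)`) -/
  bad : V → Bool
  /-- the fundamental inequality `Σ_{v | q} e_v f_v ≤ [F_tpd : ℚ]` -/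
  fund : ∀ q : ℕ, ∑ v ∈ Finset.univ.filter (fun v => p v = q), ((e v * f v : ℕ) : ℝ) ≤ deg0
  /-- Prop. 1.3 (i) over `ℚ_p`: `d_v ≥ (e_v − 1)/e_v` -/
  prop13i : ∀ v, ((e v : ℝ) - 1) / e v ≤ d v
  /-- `v ∈ Supp(𝔡^{F_tpd}_ADiv)` (i.e. `d_v > 0`) only if `v` is ramified -/
  ramified_of_d_pos : ∀ v, 0 < d v → 2 ≤ e v
  /-- the distinguished rational primes `V_ℚ^dst` -/
  dst : Finset ℕ
  /-- they are primes -/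
  dst_prime : ∀ q ∈ dst, q.Prime
  /-- (D6): a distinguished prime divides `2·3·5·l` or lies under `Supp(𝔮^{F_tpd}_ADiv + 𝔡^{F_tpd}_ADiv)` -/
  D6 : ∀ q ∈ dst, q ∣ 2 * 3 * 5 * l ∨ ∃ v, p v = q ∧ (bad v = true ∨ 0 < d v)

namespace StepIIIData

variable {V : Type*} [Fintype V] (T : StepIIIData V)

/-- `log(𝔰^ℚ) = Σ_{p ∈ V_ℚ^dst} log p`. [claim: Mochizuki2012, status: disputed] -/
def logsQ : ℝ := ∑ q ∈ T.dst, Real.log q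

/-- `log(𝔡^{F_tpd}) = (1/[F_tpd:ℚ])·Σ_v e_v f_v d_v·log p_v`. [claim: Mochizuki2012, status: disputed] -/
def logDiffTpd : ℝ := (1 / T.deg0) * ∑ v, ((T.e v * T.f v : ℕ) : ℝ) * T.d v * Real.log (T.p v)

/-- `log(𝔣^{F_tpd}) = (1/[F_tpd:ℚ])·Σ_{v bad} f_v·log p_v`. [claim: Mochizuki2012, status: disputed] -/
def logCondTpd : ℝ := (1 / T.deg0) * ∑ v, if T.bad v then (T.f v : ℝ) * Real.log (T.p v) else 0

/-- The local term of `[F_tpd:ℚ]·(log 𝔡 + log 𝔣)` at `v`. [claim: Mochizuki2012, status: disputed] -/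
def term (v : V) : ℝ :=
  ((T.e v * T.f v : ℕ) : ℝ) * T.d v * Real.log (T.p v) + if T.bad v then (T.f v : ℝ) * Real.log (T.p v) else 0

/-- `term v ≥ 0`. [folklore] -/
private theorem term_nonneg (v : V) : 0 ≤ T.term v := by
  have hl : 0 ≤ Real.log (T.p v) := Real.log_nonneg (by exact_mod_cast (T.p_prime v).one_lt.le)
  unfold term
  have := T.d_nonneg v
  cases T.bad v
  · simp only [Bool.false_eq_true, ↓reduceIte, add_zero]; positivity
  · simp only [↓reduceIte]; positivity

/-- `[F_tpd:ℚ]·(log 𝔡 + log 𝔣) = Σ_v term v`. [claim: Mochizuki2012, status: disputed] -/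
theorem deg0_mul_sum : T.deg0 * (T.logDiffTpd + T.logCondTpd) = ∑ v, T.term v := by
  unfold logDiffTpd logCondTpd term
  have hd := T.deg0_pos.ne'
  rw [Finset.sum_add_distrib, ← mul_add]
  field_simp

/-- A place under which a distinguished prime `p ∤ 30l` lies contributes `≥ log p`: bad ⟹ `f_v·log p ≥ log p`;
`d_v > 0` ⟹ `e_v ≥ 2` ⟹ `e_v f_v d_v ≥ f_v(e_v − 1) ≥ 1`. [claim: Mochizuki2012, status: disputed] -/
theorem log_le_term (v : V) (h : T.bad v = true ∨ 0 < T.d v) : Real.log (T.p v) ≤ T.term v := by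
  have hl : 0 ≤ Real.log (T.p v) := Real.log_nonneg (by exact_mod_cast (T.p_prime v).one_lt.le)
  have hf : (1 : ℝ) ≤ T.f v := by exact_mod_cast T.f_pos v
  have hdn := T.d_nonneg v
  have hdiff_nonneg : 0 ≤ ((T.e v * T.f v : ℕ) : ℝ) * T.d v * Real.log (T.p v) := by positivity
  unfold term
  rcases h with hb | hd
  · rw [hb]; simp only [↓reduceIte]; nlinarith
  · -- ramified: `e f d ≥ (e − 1) f ≥ 1`
    have he2 : (2 : ℝ) ≤ T.e v := by exact_mod_cast T.ramified_of_d_pos v hd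
    have he : (0 : ℝ) < T.e v := by linarith
    have h13 := T.prop13i v
    have hprod : (1 : ℝ) ≤ ((T.e v * T.f v : ℕ) : ℝ) * T.d v := by
      have h1 : ((T.e v : ℝ) - 1) / T.e v * T.e v = T.e v - 1 := by field_simp
      have h2 : (T.e v : ℝ) - 1 ≤ T.d v * T.e v := by
        calc (T.e v : ℝ) - 1 = ((T.e v : ℝ) - 1) / T.e v * T.e v := h1.symm
          _ ≤ T.d v * T.e v := mul_le_mul_of_nonneg_right h13 he.le
      push_cast
      nlinarith
    have hcond : 0 ≤ (if T.bad v then (T.f v : ℝ) * Real.log (T.p v) else 0) := by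
      split_ifs <;> positivity
    nlinarith

/-- The primes dividing `2·3·5·l` among the distinguished ones contribute `≤ log(2·3·5·l)`.
[claim: Mochizuki2012, status: disputed] -/
theorem sum_log_dvd_le :
    ∑ q ∈ T.dst.filter (fun q => q ∣ 2 * 3 * 5 * T.l), Real.log q ≤ Real.log (2 * 3 * 5 * (T.l : ℝ)) := by
  have hN : 0 < 2 * 3 * 5 * T.l := by have := T.l_pos; omega
  have hdvd : ∏ q ∈ T.dst.filter (fun q => q ∣ 2 * 3 * 5 * T.l), q ∣ 2 * 3 * 5 * T.l :=
    Finset.prod_primes_dvd _ (fun q hq => (T.dst_prime q (Finset.mem_filter.mp hq).1).prime)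
      (fun q hq => (Finset.mem_filter.mp hq).2)
  have hle : ((∏ q ∈ T.dst.filter (fun q => q ∣ 2 * 3 * 5 * T.l), q : ℕ) : ℝ) ≤ 2 * 3 * 5 * (T.l : ℝ) := by
    exact_mod_cast Nat.le_of_dvd hN hdvd
  have hpos : ∀ q ∈ T.dst.filter (fun q => q ∣ 2 * 3 * 5 * T.l), (0 : ℝ) < q := fun q hq =>
    by exact_mod_cast (T.dst_prime q (Finset.mem_filter.mp hq).1).pos
  rw [← Real.log_prod (fun q hq => (hpos q hq).ne')]
  push_cast at hle ⊢
  exact Real.log_le_log (Finset.prod_pos hpos) hle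

/-- The distinguished primes not dividing `2·3·5·l` contribute `≤ [F_tpd:ℚ]·(log 𝔡^{F_tpd} + log 𝔣^{F_tpd})`.
[claim: Mochizuki2012, status: disputed] -/
theorem sum_log_not_dvd_le :
    ∑ q ∈ T.dst.filter (fun q => ¬ q ∣ 2 * 3 * 5 * T.l), Real.log q ≤ T.deg0 * (T.logDiffTpd + T.logCondTpd) := by
  classical
  rw [deg0_mul_sum]
  set D' := T.dst.filter (fun q => ¬ q ∣ 2 * 3 * 5 * T.l) with hD'
  -- each such `q` lies under some place `v` with `log q ≤ term v`
  have hq : ∀ q ∈ D', Real.log q ≤ ∑ v ∈ Finset.univ.filter (fun v => T.p v = q), T.term v := by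
    intro q hq
    obtain ⟨hqd, hnd⟩ := Finset.mem_filter.mp hq
    rcases T.D6 q hqd with h | ⟨v, hv, hcase⟩
    · exact absurd h hnd
    · have hvmem : v ∈ Finset.univ.filter (fun v => T.p v = q) := by simp [hv]
      calc Real.log q = Real.log (T.p v) := by rw [hv]
        _ ≤ T.term v := T.log_le_term v hcase
        _ ≤ ∑ v ∈ Finset.univ.filter (fun v => T.p v = q), T.term v :=
            Finset.single_le_sum (fun w _ => T.term_nonneg w) hvmem
  calc ∑ q ∈ D', Real.log q ≤ ∑ q ∈ D', ∑ v ∈ Finset.univ.filter (fun v => T.p v = q), T.term v :=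
        Finset.sum_le_sum hq
    _ = ∑ q ∈ D', ∑ v ∈ (Finset.univ.filter (fun v => T.p v ∈ D')).filter (fun v => T.p v = q),
          T.term v := by
        refine Finset.sum_congr rfl fun q hqD => Finset.sum_congr ?_ fun _ _ => rfl
        ext v; simp only [Finset.mem_filter, Finset.mem_univ, true_and]
        constructor
        · intro h; exact ⟨by rw [h]; exact hqD, h⟩
        · intro h; exact h.2
    _ = ∑ v ∈ Finset.univ.filter (fun v => T.p v ∈ D'), T.term v :=
        Finset.sum_fiberwise_of_maps_to (fun v hv => (Finset.mem_filter.mp hv).2) T.term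
    _ ≤ ∑ v, T.term v :=
        Finset.sum_le_sum_of_subset_of_nonneg (Finset.filter_subset _ _) (fun v _ _ => T.term_nonneg v)

/-- **Step (iii), sharper form**: `log(𝔰^ℚ) ≤ d_mod·(log(𝔡^{F_tpd}) + log(𝔣^{F_tpd})) + log(2·3·5·l)`.
[claim: Mochizuki2012, status: disputed] -/
theorem logsQ_le : T.logsQ ≤ T.dmod * (T.logDiffTpd + T.logCondTpd) + Real.log (2 * 3 * 5 * (T.l : ℝ)) := by
  classical
  have hsplit : T.logsQ = (∑ q ∈ T.dst.filter (fun q => q ∣ 2 * 3 * 5 * T.l), Real.log q) +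
      ∑ q ∈ T.dst.filter (fun q => ¬ q ∣ 2 * 3 * 5 * T.l), Real.log q := by
    unfold logsQ; rw [Finset.sum_filter_add_sum_filter_not]
  have h1 := T.sum_log_dvd_le
  have h2 := T.sum_log_not_dvd_le
  have hnn : 0 ≤ T.logDiffTpd + T.logCondTpd := by
    have h := T.deg0_mul_sum
    have hs : 0 ≤ ∑ v, T.term v := Finset.sum_nonneg fun v _ => T.term_nonneg v
    have hd := T.deg0_pos
    nlinarith
  have hdm := T.deg0_le_dmod
  rw [hsplit]
  nlinarith

/-- **Step (iii), as printed (p. 26)**: `log(𝔰^ℚ) ≤ 2·d_mod·(log(𝔡^{F_tpd}) + log(𝔣^{F_tpd})) + log(2·3·5·l)` —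
the field `sQ_le` of `Thm110Numerics.ProofData`. [claim: Mochizuki2012, status: disputed] -/
theorem logsQ_le_printed :
    T.logsQ ≤ 2 * T.dmod * (T.logDiffTpd + T.logCondTpd) + Real.log (2 * 3 * 5 * (T.l : ℝ)) := by
  have h := T.logsQ_le
  have hnn : 0 ≤ T.logDiffTpd + T.logCondTpd := by
    have h := T.deg0_mul_sum
    have hs : 0 ≤ ∑ v, T.term v := Finset.sum_nonneg fun v _ => T.term_nonneg v
    have hd := T.deg0_pos
    nlinarith
  have hdm : 0 ≤ T.dmod := le_trans T.deg0_pos.le T.deg0_le_dmod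
  nlinarith

end StepIIIData

end Thm110StepIII

end Literature.IUT.LogVolume

end
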